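import Summits.FinalStateConjecture.FinalStateConjecture.Theorems.EIHFluxBalanceInertialRecessionChargeKinematicsClusterAlgebra

/-!
# Route EIHFluxBalance — `InertialRecession`, line `old-light-leaves-the-cone`: charge kinematics,
# XXIV (general N, mechanism (E): blocking functions, free rules, rule budgets)

Helper file for the crux `stmt-FinalStateConjecture-10166`
(`Summit.FinalStateConjecture.FinalStateConjecture.Theses.EIHFluxBalance.InertialRecession`), second line
lead, endgame stub `stub_expandingChargeKinematics` (S4: abstract quasi-conserved window charges with the
slack-form window law and the single-hole identification ⇒ Cesàro velocities of the painted centres).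
THE ESCAPE SERIES: the endgame for `N = 3` (Case A all-pairs freezing is `ChargeKinematicsAllPairs*`;
Case B, the escape of a fast hole from a velocity-tight pair, is this series; the assembly is
`ChargeKinematicsThree`).

XXIV — GENERAL N, MECHANISM (E), ATOMS: blocking functions `κ·max(m₀,|φ|) − C·d` have convex negativity sets
(`blocking_neg_between`), two breakpoints from a convex negativity set (`convex_neg_split`), the pigeonhole
over radius rules `c/(4·16^j)` (`blocks_at_most_one_rule`, `exists_free_rule`, closed versions), sign
extension (`nonneg_on_Icc_of_Ioo`), the budget along a rule (`rule_window_budget_le`) and the generic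
cluster increment from a budget bound (`cluster_increment_of_budget`).

Every statement is Mathlib-only real analysis over the stub's verbatim hypotheses ([folklore]); the abstract
charge `P` is arbitrary (adversarial), constrained only by the window law and the identification.
-/

set_option linter.dupNamespace false

noncomputable section

open Filter Set Metric Real
open scoped Topology

namespace Summit.FinalStateConjecture.FinalStateConjecture.Theorems.ChargeKinematics

open Literature.Geometry.Lorentzian

/-! ## Blocking functions and free rules -/

section RuleAtoms

open MeasureTheory intervalIntegral

/-- **Convexity of the negativity set of a blocking function.** Let `φ` grow at rate `≥ g` on `[t₁, t₂]`
(`g(s' − s) ≤ φ s' − φ s`), let `d ≥ m₀` be slow (`|d s' − d s| ≤ 2θ(s' − s)`), and let `0 < κ ≤ C`,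
`2Cθ ≤ κg`. Then the set where `B = κ·max(m₀, |φ|) − C·d` is negative is an interval: `B s₁ < 0`,
`B s₃ < 0`, `s₁ ≤ s₂ ≤ s₃` imply `B s₂ < 0`. (On the flat `|φ| ≤ m₀` one has `B ≤ κm₀ − Cm₀ ≤ 0`… strictly:
`B < 0` unless `d = m₀` and `κ = C`; we prove the strict version under `κ < C` or use `≤`.) This bounds the
number of times an internal partner enters the forbidden annulus of a radius rule during external
passages. [folklore] -/
theorem blocking_neg_between {φ d : ℝ → ℝ} {t₁ t₂ g θ κ C m₀ : ℝ} (hg : 0 < g) (hκ : 0 < κ) (hκC : κ < C)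
    (hrate : 2 * C * θ ≤ κ * g) (hm₀ : 0 < m₀)
    (hφ : ∀ s ∈ Set.Icc t₁ t₂, ∀ s' ∈ Set.Icc t₁ t₂, s ≤ s' → g * (s' - s) ≤ φ s' - φ s)
    (hd : ∀ s ∈ Set.Icc t₁ t₂, ∀ s' ∈ Set.Icc t₁ t₂, s ≤ s' → |d s' - d s| ≤ 2 * θ * (s' - s))
    (hfloor : ∀ s ∈ Set.Icc t₁ t₂, m₀ ≤ d s) {s₁ s₂ s₃ : ℝ} (hs₁ : s₁ ∈ Set.Icc t₁ t₂)
    (hs₂ : s₂ ∈ Set.Icc t₁ t₂) (hs₃ : s₃ ∈ Set.Icc t₁ t₂) (h12 : s₁ ≤ s₂) (h23 : s₂ ≤ s₃)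
    (hB₁ : κ * max m₀ |φ s₁| - C * d s₁ < 0) (hB₃ : κ * max m₀ |φ s₃| - C * d s₃ < 0) :
    κ * max m₀ |φ s₂| - C * d s₂ < 0 := by
  by_contra hcon
  push Not at hcon
  -- case analysis on `φ s₂`
  by_cases hflat : |φ s₂| ≤ m₀
  · -- on the flat: `κ m₀ - C d ≤ κ m₀ - C m₀ < 0`
    rw [max_eq_left hflat] at hcon
    have := hfloor s₂ hs₂
    nlinarith
  · push Not at hflat
    rw [max_eq_right hflat.le] at hcon
    rcases le_or_gt 0 (φ s₂) with hpos | hneg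
    · -- `φ s₂ > m₀`: push forward to `s₃`
      rw [abs_of_nonneg hpos] at hcon hflat
      have hφ₃ := hφ s₂ hs₂ s₃ hs₃ h23
      have hd₃ := hd s₂ hs₂ s₃ hs₃ h23
      rw [abs_le] at hd₃
      have hφ₃pos : m₀ < φ s₃ := by nlinarith
      have habs₃ : max m₀ |φ s₃| = φ s₃ := by
        rw [abs_of_pos (hm₀.trans hφ₃pos), max_eq_right hφ₃pos.le]
      rw [habs₃] at hB₃
      nlinarith
    · -- `φ s₂ < -m₀`: pull back to `s₁`
      rw [abs_of_neg hneg] at hcon hflat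
      have hφ₁ := hφ s₁ hs₁ s₂ hs₂ h12
      have hd₁ := hd s₁ hs₁ s₂ hs₂ h12
      rw [abs_le] at hd₁
      have hφ₁neg : φ s₁ < -m₀ := by nlinarith
      have habs₁ : max m₀ |φ s₁| = -φ s₁ := by
        rw [abs_of_neg (by linarith), max_eq_right (by linarith)]
      rw [habs₁] at hB₁
      nlinarith

/-- **Two breakpoints from a convex negativity set.** If `B` is continuous and its negativity set inside
`[t₁, t₂]` is convex (three-point form), then there are `t₁ ≤ σ⁻ ≤ σ⁺ ≤ t₂` with `B ≥ 0` on `[t₁, σ⁻]`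
(unless degenerate), `B ≤ 0` on `[σ⁻, σ⁺]` (unless degenerate) and `B ≥ 0` on `[σ⁺, t₂]` (unless degenerate).
[folklore] -/
theorem convex_neg_split {B : ℝ → ℝ} {t₁ t₂ : ℝ} (h12 : t₁ ≤ t₂) (hB : Continuous B)
    (hconv : ∀ s₁ ∈ Set.Icc t₁ t₂, ∀ s₂ ∈ Set.Icc t₁ t₂, ∀ s₃ ∈ Set.Icc t₁ t₂, s₁ ≤ s₂ → s₂ ≤ s₃ →
      B s₁ < 0 → B s₃ < 0 → B s₂ < 0) :
    ∃ σm σp : ℝ, t₁ ≤ σm ∧ σm ≤ σp ∧ σp ≤ t₂ ∧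
      (σm = t₁ ∨ ∀ s ∈ Set.Icc t₁ σm, 0 ≤ B s) ∧
      (σp = σm ∨ ∀ s ∈ Set.Icc σm σp, B s ≤ 0) ∧
      (t₂ = σp ∨ ∀ s ∈ Set.Icc σp t₂, 0 ≤ B s) := by
  by_cases hne : ∀ s ∈ Set.Icc t₁ t₂, 0 ≤ B s
  · exact ⟨t₂, t₂, h12, le_rfl, le_rfl, Or.inr fun s hs ↦ hne s hs, Or.inl rfl, Or.inl rfl⟩
  push Not at hne
  obtain ⟨s₀, hs₀, hB₀⟩ := hne
  set S : Set ℝ := {s | s ∈ Set.Icc t₁ t₂ ∧ B s < 0} with hS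
  have hSne : S.Nonempty := ⟨s₀, hs₀, hB₀⟩
  have hSbb : BddBelow S := ⟨t₁, fun s hs ↦ hs.1.1⟩
  have hSba : BddAbove S := ⟨t₂, fun s hs ↦ hs.1.2⟩
  set σm := sInf S with hσm
  set σp := sSup S with hσp
  have hσm₁ : t₁ ≤ σm := le_csInf hSne fun s hs ↦ hs.1.1
  have hσp₂ : σp ≤ t₂ := csSup_le hSne fun s hs ↦ hs.1.2
  have hσm₀ : σm ≤ s₀ := csInf_le hSbb ⟨hs₀, hB₀⟩
  have hσp₀ : s₀ ≤ σp := le_csSup hSba ⟨hs₀, hB₀⟩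
  have hmp : σm ≤ σp := hσm₀.trans hσp₀
  -- outside `[σm, σp]` the function is `≥ 0`
  have hleft : ∀ s, t₁ ≤ s → s < σm → 0 ≤ B s := by
    intro s hs hsσ
    by_contra hcon
    push Not at hcon
    exact absurd (csInf_le hSbb ⟨⟨hs, hsσ.le.trans (hmp.trans hσp₂)⟩, hcon⟩) (not_le.mpr hsσ)
  have hright : ∀ s, σp < s → s ≤ t₂ → 0 ≤ B s := by
    intro s hsσ hs
    by_contra hcon
    push Not at hcon
    exact absurd (le_csSup hSba ⟨⟨(hσm₁.trans hmp).trans hsσ.le, hs⟩, hcon⟩) (not_le.mpr hsσ)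
  -- strictly inside, `B < 0` by convexity between two points of `S`
  have hinside : ∀ s, σm < s → s < σp → B s < 0 := by
    intro s hσs hsσ
    obtain ⟨a, haS, has⟩ := exists_lt_of_csInf_lt hSne hσs
    obtain ⟨b, hbS, hsb⟩ := exists_lt_of_lt_csSup hSne hsσ
    exact hconv a haS.1 s ⟨haS.1.1.trans has.le, hsb.le.trans hbS.1.2⟩ b hbS.1 has.le hsb.le haS.2 hbS.2
  -- continuity at the two breakpoints
  have hBσm : B σm ≤ 0 := by
    -- `σm` is a limit of points of `S` (from the right) or belongs to `S`
    by_contra hcon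
    push Not at hcon
    -- `B > 0` near `σm`, contradicting `σm = inf S`
    have hopen : ∀ᶠ s in nhds σm, 0 < B s := hB.continuousAt.eventually (lt_mem_nhds hcon)
    obtain ⟨ε, hε, hball⟩ := Metric.eventually_nhds_iff.mp hopen
    obtain ⟨a, haS, haε⟩ := exists_lt_of_csInf_lt hSne (lt_add_of_pos_right σm hε)
    have hσa : σm ≤ a := csInf_le hSbb haS
    have : dist a σm < ε := by
      rw [Real.dist_eq, abs_of_nonneg (by linarith)]; linarith
    exact absurd haS.2 (not_lt.mpr (hball this).le)
  have hBσp : B σp ≤ 0 := by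
    by_contra hcon
    push Not at hcon
    have hopen : ∀ᶠ s in nhds σp, 0 < B s := hB.continuousAt.eventually (lt_mem_nhds hcon)
    obtain ⟨ε, hε, hball⟩ := Metric.eventually_nhds_iff.mp hopen
    obtain ⟨b, hbS, hbε⟩ := exists_lt_of_lt_csSup hSne (sub_lt_self σp hε)
    have hbσ : b ≤ σp := le_csSup hSba hbS
    have : dist b σp < ε := by
      rw [Real.dist_eq, abs_of_nonpos (by linarith)]; linarith
    exact absurd hbS.2 (not_lt.mpr (hball this).le)
  have hBσm' : t₁ < σm → 0 ≤ B σm := fun h ↦ by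
    -- limit from the left of nonnegative values
    have htend : Filter.Tendsto B (nhdsWithin σm (Set.Iio σm)) (nhds (B σm)) :=
      (hB.tendsto σm).mono_left nhdsWithin_le_nhds
    have hev : ∀ᶠ s in nhdsWithin σm (Set.Iio σm), 0 ≤ B s := by
      filter_upwards [Ioo_mem_nhdsLT h] with s hs
      exact hleft s hs.1.le hs.2
    exact ge_of_tendsto htend hev
  have hBσp' : σp < t₂ → 0 ≤ B σp := fun h ↦ by
    have htend : Filter.Tendsto B (nhdsWithin σp (Set.Ioi σp)) (nhds (B σp)) :=
      (hB.tendsto σp).mono_left nhdsWithin_le_nhds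
    have hev : ∀ᶠ s in nhdsWithin σp (Set.Ioi σp), 0 ≤ B s := by
      filter_upwards [Ioo_mem_nhdsGT h] with s hs
      exact hright s hs.1 hs.2.le
    exact ge_of_tendsto htend hev
  refine ⟨σm, σp, hσm₁, hmp, hσp₂, ?_, ?_, ?_⟩
  · rcases eq_or_lt_of_le hσm₁ with h | h
    · exact Or.inl h.symm
    · refine Or.inr fun s hs ↦ ?_
      rcases eq_or_lt_of_le hs.2 with h' | h'
      · rw [h']; exact hBσm' h
      · exact hleft s hs.1 h'
  · refine Or.inr fun s hs ↦ ?_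
    rcases eq_or_lt_of_le hs.1 with h | h
    · rw [← h]; exact hBσm
    · rcases eq_or_lt_of_le hs.2 with h' | h'
      · rw [h']; exact hBσp
      · exact (hinside s h h').le
  · rcases eq_or_lt_of_le hσp₂ with h | h
    · exact Or.inl h.symm
    · refine Or.inr fun s hs ↦ ?_
      rcases eq_or_lt_of_le hs.1 with h' | h'
      · rw [← h']; exact hBσp' h
      · exact hright s h' hs.2

/-- A partner blocks at most one rule: the rules `c/(4·16^j)` are a factor `16` apart while the forbidden
annulus `(R/2, 2R)` is a factor `4` wide. [folklore] -/
theorem blocks_at_most_one_rule {c d : ℝ} (hc : 0 < c) {j j' : ℕ} (hjj' : j < j')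
    (hj : c / (4 * 16 ^ j) / 2 < d ∧ d < 2 * (c / (4 * 16 ^ j)))
    (hj' : c / (4 * 16 ^ j') / 2 < d ∧ d < 2 * (c / (4 * 16 ^ j'))) : False := by
  obtain ⟨h1, -⟩ := hj
  obtain ⟨-, h2⟩ := hj'
  -- `16^{j'} ≥ 16 · 16^j`
  have hpow : (16 : ℝ) * 16 ^ j ≤ 16 ^ j' := by
    calc (16 : ℝ) * 16 ^ j = 16 ^ (j + 1) := by ring
      _ ≤ 16 ^ j' := pow_le_pow_right₀ (by norm_num) hjj'
  have h16j : (0 : ℝ) < 16 ^ j := by positivity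
  have h16j' : (0 : ℝ) < 16 ^ j' := by positivity
  -- `d > c/(8·16^j)` and `d < c/(2·16^{j'}) ≤ c/(32·16^j)`: contradiction
  have hA : c / (4 * 16 ^ j) / 2 = c / (8 * 16 ^ j) := by field_simp; ring
  have hB : 2 * (c / (4 * 16 ^ j')) = c / (2 * 16 ^ j') := by field_simp; ring
  rw [hA] at h1
  rw [hB] at h2
  have h3 : c / (2 * 16 ^ j') ≤ c / (32 * 16 ^ j) :=
    div_le_div_of_nonneg_left hc.le (by positivity) (by nlinarith)
  have h4 : c / (32 * 16 ^ j) < c / (8 * 16 ^ j) := by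
    apply div_lt_div_of_pos_left hc (by positivity) (by nlinarith)
  linarith

/-- **A free radius rule exists.** With `n + 1` rules `c/(4·16^j)` (`j ≤ n`) and at most `n` internal
partners at positive distances, some rule has no partner in its forbidden annulus. [folklore] -/
theorem exists_free_rule {ι : Type*} (T : Finset ι) {n : ℕ} (hT : T.card ≤ n) {c : ℝ} (hc : 0 < c)
    (d : ι → ℝ) :
    ∃ j : Fin (n + 1), ∀ p ∈ T, ¬ (c / (4 * 16 ^ (j : ℕ)) / 2 < d p ∧ d p < 2 * (c / (4 * 16 ^ (j : ℕ)))) := by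
  classical
  by_contra hcon
  push Not at hcon
  choose f hfT hfb using hcon
  have hinj : Function.Injective f := by
    intro j j' hjj'
    by_contra hne
    have hb := hfb j
    have hb' := hfb j'
    rw [hjj'] at hb
    rcases lt_or_gt_of_ne (Fin.val_ne_of_ne hne) with h | h
    · exact blocks_at_most_one_rule hc h hb hb'
    · exact blocks_at_most_one_rule hc h hb' hb
  have hcard : n + 1 ≤ T.card := by
    have := Finset.card_le_card_of_injOn f (s := (Finset.univ : Finset (Fin (n + 1)))) (t := T)
      (fun j _ ↦ hfT j) hinj.injOn
    simpa using this
  omega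

/-- **Budget along a radius rule.** If on `[t₀, τ]` the continuous radius `R ≥ 1` dominates
`min(max(m₀, |φ_y|)/K, c₂s)` for, at every time, SOME member `y` of a finite family of certified
coordinates (`φ_y' ≥ g_y > 0`), `K ≥ 3`, then the budget is at most the sum over `y` of the passage budgets
with floor `3m₀/K` and rate `3g_y/K` (rescaling of `passage_budget_le`). [folklore] -/
theorem rule_window_budget_le {ι : Type*} (S : Finset ι) {R : ℝ → ℝ}
    {φ φ' : ι → ℝ → ℝ} {g : ι → ℝ} {t₀ τ m₀ c₂ K : ℝ} (ht₀ : 0 < t₀) (hτ : t₀ ≤ τ) (hm₀ : 0 < m₀)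
    (hc₂ : 0 < c₂) (hK : 3 ≤ K) (hg : ∀ j ∈ S, 0 < g j) (hRcont : ContinuousOn R (Set.Icc t₀ τ))
    (hR1 : ∀ s ∈ Set.Icc t₀ τ, 1 ≤ R s)
    (hRge : ∀ s ∈ Set.Icc t₀ τ, ∃ j ∈ S, min (max m₀ |φ j s| / K) (c₂ * s) ≤ R s)
    (hφ : ∀ j ∈ S, ∀ s, HasDerivAt (φ j) (φ' j s) s) (hφ' : ∀ j ∈ S, Continuous (φ' j))
    (hmono : ∀ j ∈ S, ∀ s ∈ Set.Icc t₀ τ, g j ≤ φ' j s) :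
    ∫ s in t₀..τ, (((R s) ^ 2)⁻¹ + ((R s) ^ (7 / 4 : ℝ))⁻¹) ≤
      ∑ j ∈ S, (9 * (2 * 2 * (3 * m₀ / K) ^ (1 - 2 : ℝ) / ((2 - 1) * (3 * g j / K))) +
        (3 : ℝ) ^ (7 / 4 : ℝ) * (2 * (7 / 4) * (3 * m₀ / K) ^ (1 - 7 / 4 : ℝ) / ((7 / 4 - 1) * (3 * g j / K))) +
        ((c₂ ^ 2 * t₀)⁻¹ + 4 / 3 * c₂ ^ (-(7 / 4) : ℝ) * t₀ ^ (-(3 / 4) : ℝ))) := by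
  have hKpos : 0 < K := by linarith
  have hφc : ∀ j ∈ S, Continuous (φ j) := fun j hj ↦
    continuous_iff_continuousAt.mpr fun s ↦ (hφ j hj s).continuousAt
  have hc : ∀ j ∈ S, Continuous (fun s ↦ max 1 (min (max m₀ |φ j s| / K) (c₂ * s))) := fun j hj ↦
    continuous_const.max (((continuous_const.max (hφc j hj).abs).div_const K).min
      (continuous_const.mul continuous_id))
  have hex : ∀ s ∈ Set.Icc t₀ τ, ∃ j ∈ S, max 1 (min (max m₀ |φ j s| / K) (c₂ * s)) ≤ R s := by
    intro s hs
    obtain ⟨j, hj, hjle⟩ := hRge s hs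
    exact ⟨j, hj, max_le (hR1 s hs) hjle⟩
  have hdom := integral_budget_le_sum S (R := R) (Rp := fun j s ↦ max 1 (min (max m₀ |φ j s| / K) (c₂ * s)))
    hτ hRcont hc hR1 (fun j _ s ↦ le_max_left _ _) hex
  refine hdom.trans (Finset.sum_le_sum fun j hj ↦ ?_)
  -- rescale: `max(m₀,|φ|)/K = max(3m₀/K, |3φ/K|)/3`, rate `3g/K`
  have hm₀' : 0 < 3 * m₀ / K := by positivity
  have hg' : 0 < 3 * g j / K := by have := hg j hj; positivity
  have hφs : ∀ s, HasDerivAt (fun s ↦ 3 / K * φ j s) (3 / K * φ' j s) s := fun s ↦ (hφ j hj s).const_mul _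
  refine passage_budget_le (φ := fun s ↦ 3 / K * φ j s) (φ' := fun s ↦ 3 / K * φ' j s) ht₀ hτ hm₀' hc₂ hg'
    (hc j hj).continuousOn (fun s _ ↦ le_max_left _ _) (fun s hs ↦ ?_) hφs
    (continuous_const.mul (hφ' j hj)) (fun s hs ↦ ?_)
  · have hscale : max (3 * m₀ / K) |3 / K * φ j s| / 3 = max m₀ |φ j s| / K := by
      rw [abs_mul, abs_of_pos (by positivity : (0 : ℝ) < 3 / K)]
      have : max (3 * m₀ / K) (3 / K * |φ j s|) = 3 / K * max m₀ |φ j s| := by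
        rw [mul_max_of_nonneg _ _ (by positivity : (0 : ℝ) ≤ 3 / K)]
        congr 1; ring
      rw [this]
      field_simp
    rw [hscale]
    exact le_max_right _ _
  · have := hmono j hj s hs
    have h3K : 3 / K * g j = 3 * g j / K := by ring
    show 3 * g j / K ≤ 3 / K * φ' j s
    rw [← h3K]
    exact mul_le_mul_of_nonneg_left this (by positivity)

/-- **Increment of a cluster member from a budget bound.** Abstract form: a window law along SOME radius
with constant `C_w ≥ 0`, slack/error `≤ ε` at both ends, a bound `B` for its budget integral,
identification with the kinematic cluster charge of `U ∋ a` at both ends, internal relative velocities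
`≤ β'` ⇒ `‖v_a(s₂) − v_a(s₁)‖ ≤ 4(C_w B + 3ε)/(Σ_U M) + 2β'`. [folklore] -/
theorem cluster_increment_of_budget {ι : Type*} (U : Finset ι) {a : ι} (ha : a ∈ U) {Mc : ι → ℝ}
    {v : ι → ℝ → E3} {Qw : ℝ → Fin 4 → ℝ} {ew : ℝ → ℝ} {Cw k s₁ s₂ ε β' B I : ℝ}
    (hk1 : k < 1) (hCw : 0 ≤ Cw) (hM : ∀ c ∈ U, 0 < Mc c)
    (hvk : ∀ c ∈ U, ‖v c s₁‖ ≤ k ∧ ‖v c s₂‖ ≤ k)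
    (hr : ∀ c ∈ U, ‖v c s₁ - v a s₁‖ ≤ β' ∧ ‖v c s₂ - v a s₂‖ ≤ β')
    (hlaw : ∀ μ : Fin 4, |Qw s₂ μ - Qw s₁ μ| ≤ Cw * I + ew s₁) (hI : I ≤ B)
    (hid : ∀ s, (s = s₁ ∨ s = s₂) → |Qw s 0 - ∑ c ∈ U, Mc c * (√(1 - ‖v c s‖ ^ 2))⁻¹| ≤ ew s ∧
      ∀ k' : Fin 3, |Qw s k'.succ - ∑ c ∈ U, Mc c * (√(1 - ‖v c s‖ ^ 2))⁻¹ * v c s k'| ≤ ew s)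
    (hew : ew s₁ ≤ ε ∧ ew s₂ ≤ ε) :
    ‖v a s₂ - v a s₁‖ ≤ 4 * (Cw * B + 3 * ε) / (∑ c ∈ U, Mc c) + 2 * β' := by
  have hL : Cw * I + ew s₁ ≤ Cw * B + ε := by
    have := mul_le_mul_of_nonneg_left hI hCw
    linarith only [this, hew.1]
  have h := cluster_velocity_increment_le U ha (W₁ := Qw s₁) (W₂ := Qw s₂) hM
    (fun c hc ↦ one_le_gammaFactor ((hvk c hc).1.trans_lt hk1))
    (fun c hc ↦ one_le_gammaFactor ((hvk c hc).2.trans_lt hk1))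
    (fun c hc ↦ (hvk c hc).1.trans hk1.le) (fun c hc ↦ (hr c hc).1) (fun c hc ↦ (hr c hc).2)
    (hid s₁ (Or.inl rfl)) (hid s₂ (Or.inr rfl)) (fun μ ↦ (hlaw μ).trans hL)
  refine h.trans ?_
  have hMpos : 0 < ∑ c ∈ U, Mc c := Finset.sum_pos hM ⟨a, ha⟩
  have : 4 * (Cw * B + ε + ew s₁ + ew s₂) / (∑ c ∈ U, Mc c) ≤ 4 * (Cw * B + 3 * ε) / (∑ c ∈ U, Mc c) := by
    apply div_le_div_of_nonneg_right _ hMpos.le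
    linarith only [hew.1, hew.2]
  linarith only [this]

/-- A partner weakly blocks (closed annulus `[R/2, 2R]`) at most one rule. [folklore] -/
theorem blocks_at_most_one_rule_closed {c d : ℝ} (hc : 0 < c) {j j' : ℕ} (hjj' : j < j')
    (hj : c / (4 * 16 ^ j) / 2 ≤ d ∧ d ≤ 2 * (c / (4 * 16 ^ j)))
    (hj' : c / (4 * 16 ^ j') / 2 ≤ d ∧ d ≤ 2 * (c / (4 * 16 ^ j'))) : False := by
  obtain ⟨h1, -⟩ := hj
  obtain ⟨-, h2⟩ := hj'
  have hpow : (16 : ℝ) * 16 ^ j ≤ 16 ^ j' := by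
    calc (16 : ℝ) * 16 ^ j = 16 ^ (j + 1) := by ring
      _ ≤ 16 ^ j' := pow_le_pow_right₀ (by norm_num) hjj'
  have h16j : (0 : ℝ) < 16 ^ j := by positivity
  have hA : c / (4 * 16 ^ j) / 2 = c / (8 * 16 ^ j) := by field_simp; ring
  have hB : 2 * (c / (4 * 16 ^ j')) = c / (2 * 16 ^ j') := by field_simp; ring
  rw [hA] at h1
  rw [hB] at h2
  have h3 : c / (2 * 16 ^ j') ≤ c / (32 * 16 ^ j) :=
    div_le_div_of_nonneg_left hc.le (by positivity) (by nlinarith)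
  have h4 : c / (32 * 16 ^ j) < c / (8 * 16 ^ j) := by
    apply div_lt_div_of_pos_left hc (by positivity) (by nlinarith)
  linarith

/-- **A strictly free radius rule exists** (closed-annulus blocking): with `n + 1` rules and at most `n`
partners, some rule `j` has every partner at distance `< R_j/2` or `> 2R_j`. [folklore] -/
theorem exists_strictly_free_rule {ι : Type*} (T : Finset ι) {n : ℕ} (hT : T.card ≤ n) {c : ℝ}
    (hc : 0 < c) (d : ι → ℝ) :
    ∃ j : Fin (n + 1), ∀ p ∈ T, d p < c / (4 * 16 ^ (j : ℕ)) / 2 ∨ 2 * (c / (4 * 16 ^ (j : ℕ))) < d p := by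
  classical
  by_contra hcon
  push Not at hcon
  choose f hfT hfb using hcon
  have hinj : Function.Injective f := by
    intro j j' hjj'
    by_contra hne
    have hb := hfb j
    have hb' := hfb j'
    rw [hjj'] at hb
    rcases lt_or_gt_of_ne (Fin.val_ne_of_ne hne) with h | h
    · exact blocks_at_most_one_rule_closed hc h hb hb'
    · exact blocks_at_most_one_rule_closed hc h hb' hb
  have hcard : n + 1 ≤ T.card := by
    have := Finset.card_le_card_of_injOn f (s := (Finset.univ : Finset (Fin (n + 1)))) (t := T)
      (fun j _ ↦ hfT j) hinj.injOn
    simpa using this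
  omega

/-- Continuity extension of a sign from the open to the closed interval. [folklore] -/
theorem nonneg_on_Icc_of_Ioo {f : ℝ → ℝ} (hf : Continuous f) {a b : ℝ} (hab : a < b)
    (h : ∀ s, a < s → s < b → 0 ≤ f s) : ∀ s ∈ Set.Icc a b, 0 ≤ f s := by
  intro s hs
  rcases eq_or_lt_of_le hs.1 with h₁ | h₁
  · -- left endpoint: limit from the right
    subst h₁
    have htend : Filter.Tendsto f (nhdsWithin a (Set.Ioi a)) (nhds (f a)) :=
      (hf.tendsto a).mono_left nhdsWithin_le_nhds
    have hev : ∀ᶠ s in nhdsWithin a (Set.Ioi a), 0 ≤ f s := by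
      filter_upwards [Ioo_mem_nhdsGT hab] with s hs'
      exact h s hs'.1 hs'.2
    exact ge_of_tendsto htend hev
  · rcases eq_or_lt_of_le hs.2 with h₂ | h₂
    · subst h₂
      have htend : Filter.Tendsto f (nhdsWithin s (Set.Iio s)) (nhds (f s)) :=
        (hf.tendsto s).mono_left nhdsWithin_le_nhds
      have hev : ∀ᶠ s' in nhdsWithin s (Set.Iio s), 0 ≤ f s' := by
        filter_upwards [Ioo_mem_nhdsLT hab] with s' hs'
        exact h s' hs'.1 hs'.2
      exact ge_of_tendsto htend hev
    · exact h s h₁ h₂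

end RuleAtoms

end Summit.FinalStateConjecture.FinalStateConjecture.Theorems.ChargeKinematics

namespace Summit.FinalStateConjecture.FinalStateConjecture.Theorems

/-- REGISTERED STUB `exists_free_rule` of the crux item stmt-FinalStateConjecture-10166 (second line lead, line
`old-light-leaves-the-cone`, S4 escape series): the registered one-line signature verbatim, discharged by
`ChargeKinematics.exists_free_rule`. [folklore] -/
theorem exists_free_rule : open Literature.Geometry.Lorentzian Filter Topology MeasureTheory intervalIntegral in ∀ {ι : Type*} (T : Finset ι) {n : ℕ} (hT : T.card ≤ n) {c : ℝ} (hc : 0 < c) (d : ι → ℝ), ∃ j : Fin (n + 1), ∀ p ∈ T, ¬ (c / (4 * 16 ^ (j : ℕ)) / 2 < d p ∧ d p < 2 * (c / (4 * 16 ^ (j : ℕ)))) :=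
  @ChargeKinematics.exists_free_rule

end Summit.FinalStateConjecture.FinalStateConjecture.Theorems

end
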